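import Summits.HodgeConjecture.CorCM.Model.CorrespondenceAlgebraic
import HarnessLib

/-!
# COR-CM model layer, part 7b (row M22 `Fact_algDuality`, kernel K-c): the staged target shapes

Cell `pub-hodgecm2` (COR-CM), seat `b17`.  Companion to `CorCM/Model/CorrespondenceAlgebraic` (K-c: the action of
an algebraic correspondence preserves rational algebraic classes; base change to the point; Fourier-type sums).
The cell's staged signature file `HOME/lean/CorCM/Model/AlgDualityTargets.lean` (literature seat lit-pohlmann g2,
2026-08-20T19:05Z) fixes two K-c TARGETS as `def … : Prop` over the notations
`prSndGysin hX ha hb := gysinMap (complexOrientationRat (tensor_holds hX hX)) (complexOrientationRat hX) snd(ℂ) ha hb`,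
`corrAction hX ha hb u := prSndGysin hX ha hb ∘ₗ (BettiUniverse.cup (X ⊗ X) j k).flip u ∘ₗ BettiUniverse.pull (fst X X) j`
and `extCup X Y h x y := bettiCup h (fst^* x) (snd^* y)` (all `rfl`-abbreviations).  This file states and proves the
two targets with those notations UNFOLDED, in exactly their binder order, so that each `def` is closed by a
one-line `fun … ↦ …` wherever it lands:

* `corrAction_mem_ratAlgebraicClasses` = `AlgDuality.CorrActionPreservesAlg` unfolded: `pr₂_!(pr₁^* z ∪ u) ∈ alg X p`
  for `z ∈ alg X j`, `u ∈ alg (X ⊗ X) k` (`2j + 2k + q = 4d`, `2p + q = 2d`) — Fulton Example 19.2.7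
  «`cl(α)_*(cl_X(a)) = cl_Y(α_*(a))`», Lange 2023 §6.2.4 «`F ∘ cl = cl ∘ F`»;
* `exists_corrAction_extSum` = `AlgDuality.CorrActionExtSum` unfolded: `∃ r ≠ 0`,
  `pr₂_!(pr₁^* z ∪ Σ_c x_c ⊠ y_c) = r • Σ_c tr_X(z ∪ x_c) • y_c` (`a + s = 2d`; Lange, proof of Prop. 6.2.20:
  «`p₁^*x = x ⊗ 1`», «`p_{2*}(x ⊗ y) = d(x) y`»);
* `fourierSum_mem_ratAlgebraicClasses_of_bettiCup` — the consumable clause (i) with the cross products formed by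
  `bettiCup hk` INTO a prescribed degree `k` (`2j + 2s = k`, e.g. `k = 2i` via `(two_mul i).symm`: the spelling of
  K-b's `ℓ(θ)^i`-expansion `Model.sum_pull_cupPowOne_cup_mem_ratAlgebraicClasses`, `CorCM/Model/PoincareClass`),
  and `ratAlgebraicClasses_map_fourierSum_le_of_mem` — the operator form `(alg X p).map D ≤ alg Y s` straight from
  `Σ_c bettiCup hk (fst^* x_c) (snd^* y_c) ∈ alg (X ⊗ Y) e` (the literal clause (i) of `Fact_algDuality`).

No definitions; no named facts; explicit binders; everything is a corollary of part 7.
-/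

noncomputable section

open CategoryTheory MonoidalCategory CartesianMonoidalCategory
open Literature.AlgebraicTopology.SingularHomology
open Literature.AlgebraicGeometry.Motives (SchemeOver ComplexPoints IsSmoothProjective bettiCohomology bettiCup
  IsSmoothProjective.tensor_holds)
open Literature.AlgebraicGeometry.HodgeTheory
open Literature.NumberTheory.Automorphic.PicardCM

namespace Summit.HodgeConjecture.CorCM.Model

section Targets

variable {n m d : ℕ} {X Y : SchemeOver ℂ}

/-- **Clause (i) for Fourier-type operators, cross products into a prescribed degree**: as
`fourierSum_mem_ratAlgebraicClasses`, with `u = Σ_{c ∈ S} bettiCup hk (fst^* x_c) (snd^* y_c) ∈ Hᵏ((X ⊗ Y)(ℂ); ℚ)`,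
`2j + 2s = k`, assumed to complexify into `N^{j+s} Hᵏ`; then `Σ_{c ∈ S} tr_X(z ∪ x_c) • y_c ∈ alg Y s` for every
`z ∈ alg X p` (`p + j = dim X`). -/
theorem fourierSum_mem_ratAlgebraicClasses_of_bettiCup (hX : IsSmoothProjective n X) (hY : IsSmoothProjective m Y)
    {p j s k : ℕ} (hpj : p + j = n) (hk : 2 * j + 2 * s = k) {ι : Type*} (S : Finset ι)
    (x : ι → bettiCohomology X (2 * j)) (y : ι → bettiCohomology Y (2 * s))
    (hu : ofRatClass (ComplexPoints (X ⊗ Y)) k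
        (∑ c ∈ S, bettiCup hk (BettiUniverse.pull (fst X Y) (2 * j) (x c))
          (BettiUniverse.pull (snd X Y) (2 * s) (y c))) ∈
      supportedClasses (X ⊗ Y) k (j + s))
    {z : bettiCohomology X (2 * p)} (hz : z ∈ ratAlgebraicClasses X p) :
    ∑ c ∈ S, BettiUniverse.tr hX (2 * p + 2 * j) (BettiUniverse.cup X (2 * p) (2 * j) z (x c)) • y c ∈
      ratAlgebraicClasses Y s := by
  subst hk
  exact fourierSum_mem_ratAlgebraicClasses hX hY hpj S x y hu hz

/-- **Clause (i) of `Fact_algDuality` for a Fourier-type `D`, from a `⊠`-sum IN `alg (X ⊗ Y) e`** (the exact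
output shape of K-b's `Model.sum_pull_cupPowOne_cup_mem_ratAlgebraicClasses`, `2j + 2s = 2e`): if
`Σ_{c ∈ S} bettiCup hk (fst^* x_c) (snd^* y_c) ∈ alg (X ⊗ Y) e` then
`(alg X p).map (Σ_{c ∈ S} tr_X(– ∪ x_c) • y_c) ≤ alg Y s` (`p + j = dim X`).  For row M22: `X = Y = P`,
`p = dim P − 2`, `j = s = 2`, `e = 4`, `x_c = m₄(b ∘ c)`, `y_c = m₄(y ∘ c)`; numeral degrees `4 = 2·2`, `2·4 = 4+4`
agree definitionally, so K-a applies this with `(j := 2) (s := 2) (e := 4)`. -/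
theorem ratAlgebraicClasses_map_fourierSum_le_of_mem (hX : IsSmoothProjective n X) (hY : IsSmoothProjective m Y)
    {p j s e : ℕ} (hpj : p + j = n) (hk : 2 * j + 2 * s = 2 * e) {ι : Type*} (S : Finset ι)
    (x : ι → bettiCohomology X (2 * j)) (y : ι → bettiCohomology Y (2 * s))
    (hu : ∑ c ∈ S, bettiCup hk (BettiUniverse.pull (fst X Y) (2 * j) (x c))
        (BettiUniverse.pull (snd X Y) (2 * s) (y c)) ∈ ratAlgebraicClasses (X ⊗ Y) e) :
    (ratAlgebraicClasses X p).map
        (∑ c ∈ S, (BettiUniverse.tr hX (2 * p + 2 * j) ∘ₗ (BettiUniverse.cup X (2 * p) (2 * j)).flip (x c)).smulRight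
          (y c)) ≤
      ratAlgebraicClasses Y s := by
  obtain rfl : e = j + s := by omega
  rintro _ ⟨z, hz, rfl⟩
  have h := fourierSum_mem_ratAlgebraicClasses_of_bettiCup hX hY hpj hk S x y
    ((mem_ratAlgebraicClasses_iff _ (j + s) _).1 hu) hz
  simp only [LinearMap.coe_sum, Finset.sum_apply, LinearMap.smulRight_apply, LinearMap.coe_comp,
    Function.comp_apply, LinearMap.flip_apply]
  exact h

/-- **`AlgDuality.CorrActionPreservesAlg`, unfolded — the action of an algebraic correspondence preserves
algebraic classes**: for `X` smooth projective of dimension `d`, `z ∈ alg X j` and `u ∈ alg (X ⊗ X) k`,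
`pr₂_!(pr₁^* z ∪ u) ∈ alg X p` (`2j + 2k + q = 2(d + d)`, `2p + q = 2d`, i.e. `p = j + k − d`). -/
theorem corrAction_mem_ratAlgebraicClasses (hX : IsSmoothProjective d X) (j k p q : ℕ)
    (ha : 2 * j + 2 * k + q = 2 * (d + d)) (hb : 2 * p + q = 2 * d) (z : bettiCohomology X (2 * j))
    (u : bettiCohomology (X ⊗ X) (2 * k)) (hz : z ∈ ratAlgebraicClasses X j)
    (hu : u ∈ ratAlgebraicClasses (X ⊗ X) k) :
    gysinMap (complexOrientationRat (IsSmoothProjective.tensor_holds hX hX)) (complexOrientationRat hX)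
        (Literature.AlgebraicGeometry.Motives.AlgPoints.mapContinuous (L := ℂ) (snd X X)) ha hb
        (BettiUniverse.cup (X ⊗ X) (2 * j) (2 * k) (BettiUniverse.pull (fst X X) (2 * j) z) u) ∈
      ratAlgebraicClasses X p :=
  gysin_cup_pull_mem_ratAlgebraicClasses (IsSmoothProjective.tensor_holds hX hX) hX hX (fst X X) (snd X X) ha hb
    hu hz

/-- **`AlgDuality.CorrActionExtSum`, unfolded — the correspondence action of a `⊠`-sum is the Fourier-type
operator, up to the base-change constant**: for `X` smooth projective of dimension `d` and degrees `a + s = 2d`,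
`a + (s + t) + q = 2(d + d)`, `t + q = 2d`, there is `r ∈ ℚ`, `r ≠ 0`, with
`pr₂_!(pr₁^* z ∪ Σ_c fst^* x_c ∪ snd^* y_c) = r • Σ_c tr_X(z ∪ x_c) • y_c` for all finite families `x`, `y` and
all `z`. -/
theorem exists_corrAction_extSum (hX : IsSmoothProjective d X) (a s t q : ℕ) (hast : a + s = 2 * d)
    (ha : a + (s + t) + q = 2 * (d + d)) (hb : t + q = 2 * d) :
    ∃ r : ℚ, r ≠ 0 ∧ ∀ {ι : Type} [Fintype ι] (x : ι → bettiCohomology X s) (y : ι → bettiCohomology X t)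
      (z : bettiCohomology X a),
      gysinMap (complexOrientationRat (IsSmoothProjective.tensor_holds hX hX)) (complexOrientationRat hX)
          (Literature.AlgebraicGeometry.Motives.AlgPoints.mapContinuous (L := ℂ) (snd X X)) ha hb
          (BettiUniverse.cup (X ⊗ X) a (s + t) (BettiUniverse.pull (fst X X) a z)
            (∑ c, bettiCup (rfl : s + t = s + t) (BettiUniverse.pull (fst X X) s (x c))
              (BettiUniverse.pull (snd X X) t (y c)))) =
        r • ∑ c, BettiUniverse.tr hX (a + s) (BettiUniverse.cup X a s z (x c)) • y c := by
  obtain ⟨r, hr0, hr⟩ := exists_gysin_snd_pull_fst hX hX (k := a + s) hast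
  exact ⟨r, hr0, fun x y z ↦ gysin_snd_cup_pull_fst_sum hX hX r hr ha hb Finset.univ z x y⟩

end Targets

end Summit.HodgeConjecture.CorCM.Model

end
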